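import Mathlib
import Literature.NumberTheory.NumberFields.ClassGroupPrimesAvoiding
import HarnessLib

/-!
# Every ideal class contains an integral ideal prime to a given ideal; prime-to-`p` natural numbers in an ideal

Topic `Literature/NumberTheory/NumberFields`, namespace `Literature.NumberTheory.NumberFields`.  THEOREMS ONLY (no `def`, no instance,
no named fact), Mathlib + ★ `ClassGroupPrimesAvoiding` («the class group is generated by the primes outside any finite set», prime case of the
avoidance lemma by the Chinese remainder theorem).

## Source (read at the page) and what is recorded

J. Neukirch, *Algebraic Number Theory* (1999) [NeukirchANT1999], Ch. I §3 (Dedekind domains: unique factorisation, the approximation step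
«`(a) = 𝔭 𝔟` with `𝔟` prime to a given finite set») and Ch. VI §1 (ray class groups; the classical exercise «every class of `Cl_K` contains an integral
ideal prime to a given ideal `𝔪`», used before (1.9) p. 364 to write `Cl_K` as a quotient of `J_K^𝔪`); J. S. Milne, *Algebraic Number Theory* (v3.00)
[MilneANT2008], Thm. 3.7 (p. 42) (ideals of a Dedekind domain factor uniquely into primes; «`N(𝔞) ∈ 𝔞`»).  Cell `hodgecm-mathlib`, «GO 500» line L3
(`stub_FROB`), LA3-plan DEAL 03:50:51Z (NT-𝔟)+(NT-n): the two arithmetic inputs of the prime-to-`p` re-presentation road (ρ-𝔟) («replace `𝔭_w` by an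
integral `𝔟 ~ 𝔭_w` with `𝔟 ⊔ (pN) = ⊤`, then `A ⊗ 𝔭_w⁻¹ ≅ A ⊗ 𝔟⁻¹ ≅ A ⧸ A[𝔟]` is an étale quotient of order prime to `p`»).

* §1 (any Dedekind domain `R`) `exists_mul_eq_span_and_forall_not_dvd` — for `I ≠ 0` and a finite set `S` of primes there are `a ≠ 0` and `𝔟` with
  `I · 𝔟 = (a)` and NO prime of `S` dividing `𝔟` (induction on the prime factorisation of `I` over the ★ prime case
  `ClassGroup.exists_mul_eq_span_and_forall_not_mem`); `sup_eq_top_iff_forall_not_dvd` (`I ⊔ m = ⊤` iff no prime factor of `m` divides `I`);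
  **`exists_mk0_eq_and_forall_not_dvd`** / **`exists_mk0_eq_and_sup_eq_top`** — every class `c ∈ Cl(R)` is `[I]` for an integral `I` avoiding `S`, resp.
  with `I ⊔ m = ⊤`.
* §2 (NT-𝔟) **`exists_coprime_representative`** — for `𝔞 ≠ 0`, `m ≠ 0` there are `x ∈ K^×` and `𝔟` with `𝔟 ⊔ m = ⊤` and `𝔟 = (x) · 𝔞` as fractional
  ideals (the dealt token, through Mathlib `ClassGroup.mk0_eq_mk0_iff_exists_fraction_ring`); integral form `exists_coprime_representative'`
  (`(a) · 𝔟 = (b) · 𝔞`); the `𝓞 F`-costume `RingOfIntegers.exists_coprime_representative`.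
* §3 (NT-n) **`exists_nat_mem_not_dvd`** — `𝔟 ≠ 0`, `𝔟 ⊔ (p) = ⊤` (`p ≠ 1`) ⇒ some `n ≥ 1` with `p ∤ n` lies in `𝔟` (strip the `p`-part of `N𝔟 ∈ 𝔟`);
  the CM product form **`exists_nat_mem_mul_complexConj_smul_not_dvd`** (`n ∈ 𝔟 · c𝔟`, what an `hlam : (n) ⊆ 𝔟 𝔟̄` input reads) with its two
  lemmas `pointwise_smul_ne_bot`, `pointwise_smul_sup_eq_top_of_sup_span_natCast_eq_top`; and the package `exists_coprime_representative_nat_mem`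
  ((NT-𝔟)+(NT-n) at once for `m ≤ (p)`).
`--supports stmt-HodgeConjecture-24832`, count-neutral.

## Mathlib / tree search

Mathlib (MISS for the coprime representative itself): `ClassGroup.integralRep` / `ClassGroup.mk0_surjective` (integral representative, no coprimality),
`ClassGroup.mk0_eq_mk0_iff_exists_fraction_ring`, `ClassGroup.mk0_eq_mk0_iff`, `ClassGroup.mk0_eq_mk0_inv_iff`, `Ideal.finite_factors`,
`UniqueFactorizationMonoid.induction_on_prime`, `Ideal.absNorm_mem`, `Ideal.absNorm_eq_zero_iff`, `Nat.exists_eq_pow_mul_and_not_dvd`, `Ideal.sup_pow_eq_top`,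
`Ideal.sup_mul_eq_of_coprime_left`, `Ideal.smul_sup`, `Ideal.pointwise_smul_def`; tree ★ `ClassGroupPrimesAvoiding` (prime case + generation), ★
`PureCubicRationalGenus.Honda1971.exists_mk0_eq_forall_not_dvd_absNorm` (number fields, avoidance of RATIONAL primes — not imported), ★
`PrimesInIdealClasses.infinite_setOf_primeClass_eq` (Chebotarev form: degree-one PRIME representatives — stronger, not needed here, not imported).
-/

namespace Literature.NumberTheory.NumberFields

open NumberField IsDedekindDomain
open scoped nonZeroDivisors Pointwise

/-! ### §1 Integral ideals avoiding a finite set of primes, in every ideal class (any Dedekind domain) -/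

section Dedekind

variable {R : Type*} [CommRing R] [IsDedekindDomain R]

/-- **Moving a nonzero ideal off a finite set of primes**: for `I ≠ 0` and a finite set `S` of primes there are `a ≠ 0` and an ideal `𝔟` with
`I · 𝔟 = (a)` and no prime of `S` dividing `𝔟` (induction on the prime factorisation of `I`; the prime case is the tree's CRT lemma
`ClassGroup.exists_mul_eq_span_and_forall_not_mem`). [cite: NeukirchANT1999, Ch. I §3 (approximation theorem in Dedekind domains)] -/
theorem exists_mul_eq_span_and_forall_not_dvd (I : Ideal R) (hI : I ≠ ⊥) (S : Finset (HeightOneSpectrum R)) :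
    ∃ (a : R) (𝔟 : Ideal R), a ≠ 0 ∧ I * 𝔟 = Ideal.span {a} ∧ ∀ w ∈ S, ¬ w.asIdeal ∣ 𝔟 := by
  classical
  revert hI
  refine UniqueFactorizationMonoid.induction_on_prime I ?_ ?_ ?_
  · intro h
    exact absurd rfl h
  · intro u hu _
    have hu' : u = ⊤ := Ideal.isUnit_iff.mp hu
    subst hu'
    refine ⟨1, ⊤, one_ne_zero, by rw [Ideal.top_mul, Ideal.span_singleton_one], fun w _ hw => ?_⟩
    exact w.isPrime.ne_top (top_le_iff.mp (Ideal.dvd_iff_le.mp hw))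
  · intro J p hJ hp ih _
    obtain ⟨a₁, 𝔟₁, ha₁, h₁, hS₁⟩ :=
      ClassGroup.exists_mul_eq_span_and_forall_not_mem (⟨p, Ideal.isPrime_of_prime hp, hp.ne_zero⟩ : HeightOneSpectrum R) S
    obtain ⟨a₂, 𝔟₂, ha₂, h₂, hS₂⟩ := ih hJ
    have h₁' : p * 𝔟₁ = Ideal.span {a₁} := h₁
    refine ⟨a₁ * a₂, 𝔟₁ * 𝔟₂, mul_ne_zero ha₁ ha₂, ?_, fun w hw hdvd => ?_⟩
    · calc p * J * (𝔟₁ * 𝔟₂) = (p * 𝔟₁) * (J * 𝔟₂) := by ring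
        _ = Ideal.span {a₁ * a₂} := by rw [h₁', h₂, Ideal.span_singleton_mul_span_singleton]
    · rcases w.prime.dvd_or_dvd hdvd with h | h
      · exact hS₁ w hw h
      · exact hS₂ w hw h

/-- `I ⊔ m = ⊤` iff no prime dividing `m` divides `I` (`m ≠ 0`; a proper ideal `I ⊔ m` lies in a maximal ideal, which is a nonzero prime dividing both).
[cite: MilneANT2008, Thm. 3.7 (p. 42)] -/
theorem sup_eq_top_iff_forall_not_dvd {I m : Ideal R} (hm : m ≠ ⊥) :
    I ⊔ m = ⊤ ↔ ∀ w : HeightOneSpectrum R, w.asIdeal ∣ m → ¬ w.asIdeal ∣ I := by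
  constructor
  · intro h w hwm hwI
    have hle : I ⊔ m ≤ w.asIdeal := sup_le (Ideal.le_of_dvd hwI) (Ideal.le_of_dvd hwm)
    rw [h, top_le_iff] at hle
    exact w.isPrime.ne_top hle
  · intro h
    by_contra hne
    obtain ⟨P, hPmax, hle⟩ := Ideal.exists_le_maximal (I ⊔ m) hne
    have hP0 : P ≠ ⊥ := by
      rintro rfl
      exact hm (le_bot_iff.mp (le_sup_right.trans hle))
    exact h ⟨P, hPmax.isPrime, hP0⟩ (Ideal.dvd_iff_le.mpr (le_sup_right.trans hle)) (Ideal.dvd_iff_le.mpr (le_sup_left.trans hle))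

/-- **Every ideal class contains an integral ideal none of whose prime factors lies in a given finite set `S`.**  (Apply the avoidance lemma to an
integral `J` with `[J] = c⁻¹`: `J · 𝔟 = (a)` gives `[𝔟] = [J]⁻¹ = c`.) [cite: NeukirchANT1999, Ch. VI §1 (every class of `Cl_K` contains an ideal prime to a given ideal)] -/
theorem exists_mk0_eq_and_forall_not_dvd (S : Finset (HeightOneSpectrum R)) (c : ClassGroup R) :
    ∃ I : (Ideal R)⁰, ClassGroup.mk0 I = c ∧ ∀ w ∈ S, ¬ w.asIdeal ∣ (I : Ideal R) := by
  obtain ⟨⟨J, hJ⟩, hJc⟩ := ClassGroup.mk0_surjective c⁻¹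
  have hJ0 : J ≠ ⊥ := mem_nonZeroDivisors_iff_ne_zero.mp hJ
  obtain ⟨a, 𝔟, ha0, hab, h𝔟S⟩ := exists_mul_eq_span_and_forall_not_dvd J hJ0 S
  have h𝔟0 : 𝔟 ≠ ⊥ := by
    rintro rfl
    rw [Ideal.mul_bot, eq_comm, Ideal.span_singleton_eq_bot] at hab
    exact ha0 hab
  refine ⟨⟨𝔟, mem_nonZeroDivisors_iff_ne_zero.mpr h𝔟0⟩, ?_, h𝔟S⟩
  have hinv : ClassGroup.mk0 ⟨J, hJ⟩ = (ClassGroup.mk0 ⟨𝔟, mem_nonZeroDivisors_iff_ne_zero.mpr h𝔟0⟩)⁻¹ :=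
    ClassGroup.mk0_eq_mk0_inv_iff.mpr ⟨a, ha0, hab⟩
  rw [hJc] at hinv
  exact (inv_inj.mp hinv).symm

/-- **Every ideal class contains an integral ideal prime to a given nonzero ideal `m`** (`I ⊔ m = ⊤`). [cite: NeukirchANT1999, Ch. VI §1 (every class of `Cl_K` contains an ideal prime to a given ideal)] -/
theorem exists_mk0_eq_and_sup_eq_top {m : Ideal R} (hm : m ≠ ⊥) (c : ClassGroup R) :
    ∃ I : (Ideal R)⁰, ClassGroup.mk0 I = c ∧ (I : Ideal R) ⊔ m = ⊤ := by
  obtain ⟨I, hIc, hIS⟩ := exists_mk0_eq_and_forall_not_dvd (Ideal.finite_factors hm).toFinset c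
  refine ⟨I, hIc, (sup_eq_top_iff_forall_not_dvd hm).mpr fun w hwm => hIS w ?_⟩
  exact (Set.Finite.mem_toFinset _).mpr hwm

/-! ### §2 (NT-𝔟) The coprime representative in fractional-ideal currency -/

variable {K : Type*} [Field K] [Algebra R K] [IsFractionRing R K]

/-- **(NT-𝔟) COPRIME CLASS REPRESENTATIVE**: for nonzero integral ideals `𝔞`, `m` of a Dedekind domain `R` with fraction field `K` there are `x ∈ K^×`
and an integral ideal `𝔟` with `𝔟 ⊔ m = ⊤` and `𝔟 = (x) · 𝔞` as fractional ideals (so `𝔟 ≅ 𝔞` as `R`-modules and `[𝔟] = [𝔞]`).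
[cite: NeukirchANT1999, Ch. VI §1 (every class of `Cl_K` contains an ideal prime to a given ideal)] -/
theorem exists_coprime_representative (𝔞 m : Ideal R) (h𝔞 : 𝔞 ≠ ⊥) (hm : m ≠ ⊥) :
    ∃ (x : K) (𝔟 : Ideal R), x ≠ 0 ∧ 𝔟 ⊔ m = ⊤ ∧
      (𝔟 : FractionalIdeal R⁰ K) = FractionalIdeal.spanSingleton R⁰ x * (𝔞 : FractionalIdeal R⁰ K) := by
  obtain ⟨I, hIc, hIm⟩ := exists_mk0_eq_and_sup_eq_top hm (ClassGroup.mk0 ⟨𝔞, mem_nonZeroDivisors_iff_ne_zero.mpr h𝔞⟩)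
  obtain ⟨x, hx, hxI⟩ := (ClassGroup.mk0_eq_mk0_iff_exists_fraction_ring K).mp hIc.symm
  exact ⟨x, I, hx, hIm, hxI.symm⟩

/-- (NT-𝔟), integral form: `(a) · 𝔟 = (b) · 𝔞` with `a, b ≠ 0` and `𝔟 ⊔ m = ⊤`. [cite: NeukirchANT1999, Ch. VI §1 (every class of `Cl_K` contains an ideal prime to a given ideal)] -/
theorem exists_coprime_representative' (𝔞 m : Ideal R) (h𝔞 : 𝔞 ≠ ⊥) (hm : m ≠ ⊥) :
    ∃ (a b : R) (𝔟 : Ideal R), a ≠ 0 ∧ b ≠ 0 ∧ 𝔟 ⊔ m = ⊤ ∧ Ideal.span {a} * 𝔟 = Ideal.span {b} * 𝔞 := by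
  obtain ⟨I, hIc, hIm⟩ := exists_mk0_eq_and_sup_eq_top hm (ClassGroup.mk0 ⟨𝔞, mem_nonZeroDivisors_iff_ne_zero.mpr h𝔞⟩)
  obtain ⟨a, b, ha, hb, hab⟩ := ClassGroup.mk0_eq_mk0_iff.mp hIc
  exact ⟨a, b, I, ha, hb, hIm, hab⟩

omit [IsDedekindDomain R] in
/-- (NT-𝔟), nonvanishing of the representative: an ideal with `𝔟 ⊔ m = ⊤`, `m ≠ ⊤`, is nonzero; in the fractional-ideal form `𝔟 = (x) · 𝔞` with
`x ≠ 0`, `𝔞 ≠ 0` this also follows from `FractionalIdeal.coeIdeal_eq_zero`. [cite: MilneANT2008, Thm. 3.7 (p. 42)] -/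
theorem ne_bot_of_sup_eq_top {𝔟 m : Ideal R} (hm : m ≠ ⊤) (h : 𝔟 ⊔ m = ⊤) : 𝔟 ≠ ⊥ := by
  rintro rfl
  exact hm (by simpa using h)

end Dedekind

/-! ### The `𝓞 F`-costume of (NT-𝔟) -/

section NumberField

variable {F : Type*} [Field F] [NumberField F]

/-- **(NT-𝔟) for the ring of integers of a number field**, in the exact token shape of the L3 deal:
`∃ (x : F) (𝔟 : Ideal (𝓞 F)), x ≠ 0 ∧ 𝔟 ⊔ m = ⊤ ∧ ↑𝔟 = FractionalIdeal.spanSingleton (𝓞 F)⁰ x * ↑𝔞`.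
[cite: NeukirchANT1999, Ch. VI §1 (every class of `Cl_K` contains an ideal prime to a given ideal)] -/
theorem RingOfIntegers.exists_coprime_representative (𝔞 m : Ideal (𝓞 F)) (h𝔞 : 𝔞 ≠ ⊥) (hm : m ≠ ⊥) :
    ∃ (x : F) (𝔟 : Ideal (𝓞 F)), x ≠ 0 ∧ 𝔟 ⊔ m = ⊤ ∧
      (𝔟 : FractionalIdeal (𝓞 F)⁰ F) = FractionalIdeal.spanSingleton (𝓞 F)⁰ x * (𝔞 : FractionalIdeal (𝓞 F)⁰ F) :=
  _root_.Literature.NumberTheory.NumberFields.exists_coprime_representative 𝔞 m h𝔞 hm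

/-! ### §3 (NT-n) Prime-to-`p` natural numbers in an ideal prime to `p` -/

/-- **(NT-n) PRIME-TO-`p` EXPONENT**: if `𝔟 ≠ 0` and `𝔟 ⊔ (p) = ⊤` (`p ≠ 1`) then some natural number `n ≥ 1` with `p ∤ n` lies in `𝔟`.  Proof:
`N𝔟 ∈ 𝔟` (`Ideal.absNorm_mem`); write `N𝔟 = p^e · n` with `p ∤ n`; from `𝔟 + (p^e) = (1)`, `1 = b + y p^e`, get `n = n b + y · N𝔟 ∈ 𝔟`.
[cite: MilneANT2008, Thm. 3.7 (p. 42)] -/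
theorem exists_nat_mem_not_dvd {𝔟 : Ideal (𝓞 F)} (h𝔟 : 𝔟 ≠ ⊥) {p : ℕ} (hp : p ≠ 1)
    (hcop : 𝔟 ⊔ Ideal.span {((p : ℕ) : 𝓞 F)} = ⊤) : ∃ n : ℕ, 0 < n ∧ ¬ p ∣ n ∧ ((n : ℕ) : 𝓞 F) ∈ 𝔟 := by
  have hN0 : Ideal.absNorm 𝔟 ≠ 0 := by rwa [Ne, Ideal.absNorm_eq_zero_iff]
  have hNmem : ((Ideal.absNorm 𝔟 : ℕ) : 𝓞 F) ∈ 𝔟 := Ideal.absNorm_mem 𝔟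
  obtain ⟨e, n, hn, hNeq⟩ := Nat.exists_eq_pow_mul_and_not_dvd hN0 p hp
  have hn0 : n ≠ 0 := by
    rintro rfl
    rw [mul_zero] at hNeq
    exact hN0 hNeq
  refine ⟨n, Nat.pos_of_ne_zero hn0, hn, ?_⟩
  have htop : 𝔟 ⊔ Ideal.span {((p : ℕ) : 𝓞 F) ^ e} = ⊤ := by
    rw [← Ideal.span_singleton_pow]
    exact Ideal.sup_pow_eq_top hcop
  obtain ⟨b, hb, q, hq, hbq⟩ := Submodule.mem_sup.mp ((Ideal.eq_top_iff_one _).mp htop)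
  obtain ⟨y, rfl⟩ := Ideal.mem_span_singleton'.mp hq
  have key : ((n : ℕ) : 𝓞 F) = ((n : ℕ) : 𝓞 F) * b + y * ((Ideal.absNorm 𝔟 : ℕ) : 𝓞 F) := by
    rw [hNeq]
    push_cast
    linear_combination (-((n : ℕ) : 𝓞 F)) * hbq
  rw [key]
  exact 𝔟.add_mem (𝔟.mul_mem_left _ hb) (𝔟.mul_mem_left _ hNmem)

/-- (NT-n) in coprimality costume: `Nat.Coprime n p` for a prime `p`. [cite: MilneANT2008, Thm. 3.7 (p. 42)] -/
theorem exists_nat_mem_coprime {𝔟 : Ideal (𝓞 F)} (h𝔟 : 𝔟 ≠ ⊥) {p : ℕ} (hp : p.Prime)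
    (hcop : 𝔟 ⊔ Ideal.span {((p : ℕ) : 𝓞 F)} = ⊤) : ∃ n : ℕ, 0 < n ∧ Nat.Coprime n p ∧ ((n : ℕ) : 𝓞 F) ∈ 𝔟 := by
  obtain ⟨n, hn0, hn, hmem⟩ := exists_nat_mem_not_dvd h𝔟 hp.one_lt.ne' hcop
  exact ⟨n, hn0, (Nat.coprime_comm.mp ((Nat.Prime.coprime_iff_not_dvd hp).mpr hn)), hmem⟩

section Pointwise

variable {G : Type*} [Group G] [MulSemiringAction G (𝓞 F)]

omit [NumberField F] in
/-- A Galois conjugate `σ𝔟` of a nonzero ideal is nonzero (`σ` acts by ring automorphisms). [cite: NeukirchANT1999, Ch. I §9 (conjugate ideals `σ𝔞` under automorphisms, before (9.1))] -/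
theorem pointwise_smul_ne_bot (g : G) {𝔟 : Ideal (𝓞 F)} (h𝔟 : 𝔟 ≠ ⊥) : g • 𝔟 ≠ ⊥ := by
  intro h0
  apply h𝔟
  have := congrArg (fun J : Ideal (𝓞 F) => g⁻¹ • J) h0
  simpa using this

omit [NumberField F] in
/-- `𝔟 ⊔ (p) = ⊤ ⇒ σ𝔟 ⊔ (p) = ⊤` (`σ` fixes the natural number `p` and `σ • (1) = (1)`: conjugation by a ring automorphism preserves coprimality with a rational integer). [cite: NeukirchANT1999, Ch. I §9 (conjugate ideals `σ𝔞` under automorphisms, before (9.1))] -/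
theorem pointwise_smul_sup_eq_top_of_sup_span_natCast_eq_top (g : G) {𝔟 : Ideal (𝓞 F)} {p : ℕ}
    (hcop : 𝔟 ⊔ Ideal.span {((p : ℕ) : 𝓞 F)} = ⊤) : g • 𝔟 ⊔ Ideal.span {((p : ℕ) : 𝓞 F)} = ⊤ := by
  have htop : g • (⊤ : Ideal (𝓞 F)) = ⊤ := by
    rw [Ideal.pointwise_smul_def]
    exact Ideal.map_top _
  have hspan : g • Ideal.span {((p : ℕ) : 𝓞 F)} = Ideal.span {((p : ℕ) : 𝓞 F)} := by
    rw [Ideal.smul_closure, Set.smul_set_singleton, ← MulSemiringAction.toRingHom_apply, map_natCast]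
  have := congrArg (fun J : Ideal (𝓞 F) => g • J) hcop
  simpa only [Ideal.smul_sup, hspan, htop] using this

omit [NumberField F] in
/-- `𝔟 ⊔ (p) = ⊤ ⇒ (𝔟 · σ𝔟) ⊔ (p) = ⊤` (a product of ideals prime to `(p)` is prime to `(p)`). [cite: NeukirchANT1999, Ch. I §9 (conjugate ideals `σ𝔞` under automorphisms, before (9.1))] -/
theorem mul_pointwise_smul_sup_eq_top_of_sup_span_natCast_eq_top (g : G) {𝔟 : Ideal (𝓞 F)} {p : ℕ}
    (hcop : 𝔟 ⊔ Ideal.span {((p : ℕ) : 𝓞 F)} = ⊤) : 𝔟 * g • 𝔟 ⊔ Ideal.span {((p : ℕ) : 𝓞 F)} = ⊤ := by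
  rw [Ideal.mul_sup_eq_of_coprime_left hcop]
  exact pointwise_smul_sup_eq_top_of_sup_span_natCast_eq_top g hcop

end Pointwise

/-- **(NT-n), CM PRODUCT FORM**: for a CM field `F` with complex conjugation `c`, if `𝔟 ≠ 0` and `𝔟 ⊔ (p) = ⊤` (`p ≠ 1`) then some `n ≥ 1` with `p ∤ n` lies
in `𝔟 · c𝔟` (hence `(n) ⊆ 𝔟 𝔟̄`, the shape an isotropy input `hlam` reads; a fortiori `n ∈ 𝔟`). [cite: MilneANT2008, Thm. 3.7 (p. 42)] -/
theorem exists_nat_mem_mul_complexConj_smul_not_dvd [IsCMField F] {𝔟 : Ideal (𝓞 F)} (h𝔟 : 𝔟 ≠ ⊥) {p : ℕ} (hp : p ≠ 1)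
    (hcop : 𝔟 ⊔ Ideal.span {((p : ℕ) : 𝓞 F)} = ⊤) :
    ∃ n : ℕ, 0 < n ∧ ¬ p ∣ n ∧ ((n : ℕ) : 𝓞 F) ∈ 𝔟 * (IsCMField.complexConj F) • 𝔟 :=
  exists_nat_mem_not_dvd (mul_ne_zero h𝔟 (pointwise_smul_ne_bot (IsCMField.complexConj F) h𝔟)) hp
    (mul_pointwise_smul_sup_eq_top_of_sup_span_natCast_eq_top (IsCMField.complexConj F) hcop)

/-- `(n) ⊆ 𝔟 · c𝔟` costume of the CM product form. [cite: MilneANT2008, Thm. 3.7 (p. 42)] -/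
theorem exists_span_natCast_le_mul_complexConj_smul [IsCMField F] {𝔟 : Ideal (𝓞 F)} (h𝔟 : 𝔟 ≠ ⊥) {p : ℕ} (hp : p ≠ 1)
    (hcop : 𝔟 ⊔ Ideal.span {((p : ℕ) : 𝓞 F)} = ⊤) :
    ∃ n : ℕ, 0 < n ∧ ¬ p ∣ n ∧ Ideal.span {((n : ℕ) : 𝓞 F)} ≤ 𝔟 * (IsCMField.complexConj F) • 𝔟 := by
  obtain ⟨n, hn0, hn, hmem⟩ := exists_nat_mem_mul_complexConj_smul_not_dvd h𝔟 hp hcop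
  exact ⟨n, hn0, hn, (Ideal.span_singleton_le_iff_mem _).mpr hmem⟩

/-- **(NT-𝔟)+(NT-n) PACKAGED** (the (ρ-𝔟) input in one `obtain`): for `𝔞 ≠ 0`, a nonzero `m ⊆ (p)` (e.g. `m = (pN)`) and `p ≠ 1`, there are `x ∈ F^×`,
an integral `𝔟 = (x) · 𝔞` with `𝔟 ⊔ m = ⊤` (so `𝔟 ≠ 0`, `𝔟 ⊔ (p) = ⊤`), and `n ≥ 1`, `p ∤ n`, with `n ∈ 𝔟 · c𝔟 ⊆ 𝔟`.
[cite: NeukirchANT1999, Ch. VI §1 (every class of `Cl_K` contains an ideal prime to a given ideal)] -/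
theorem exists_coprime_representative_nat_mem [IsCMField F] (𝔞 m : Ideal (𝓞 F)) (h𝔞 : 𝔞 ≠ ⊥) (hm : m ≠ ⊥) {p : ℕ} (hp : p ≠ 1)
    (hmp : m ≤ Ideal.span {((p : ℕ) : 𝓞 F)}) :
    ∃ (x : F) (𝔟 : Ideal (𝓞 F)) (n : ℕ), x ≠ 0 ∧ 𝔟 ≠ ⊥ ∧ 𝔟 ⊔ m = ⊤ ∧ 𝔟 ⊔ Ideal.span {((p : ℕ) : 𝓞 F)} = ⊤ ∧
      (𝔟 : FractionalIdeal (𝓞 F)⁰ F) = FractionalIdeal.spanSingleton (𝓞 F)⁰ x * (𝔞 : FractionalIdeal (𝓞 F)⁰ F) ∧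
      0 < n ∧ ¬ p ∣ n ∧ ((n : ℕ) : 𝓞 F) ∈ 𝔟 * (IsCMField.complexConj F) • 𝔟 ∧ ((n : ℕ) : 𝓞 F) ∈ 𝔟 := by
  obtain ⟨x, 𝔟, hx, h𝔟m, h𝔟x⟩ := RingOfIntegers.exists_coprime_representative 𝔞 m h𝔞 hm
  have h𝔟0 : 𝔟 ≠ ⊥ := by
    rintro rfl
    rw [FractionalIdeal.coeIdeal_bot, eq_comm, mul_eq_zero, FractionalIdeal.spanSingleton_eq_zero_iff,
      FractionalIdeal.coeIdeal_eq_zero] at h𝔟x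
    rcases h𝔟x with h | h
    · exact hx h
    · exact h𝔞 h
  have h𝔟p : 𝔟 ⊔ Ideal.span {((p : ℕ) : 𝓞 F)} = ⊤ := top_le_iff.mp (h𝔟m.ge.trans (sup_le_sup_left hmp _))
  obtain ⟨n, hn0, hn, hmem⟩ := exists_nat_mem_mul_complexConj_smul_not_dvd h𝔟0 hp h𝔟p
  exact ⟨x, 𝔟, n, hx, h𝔟0, h𝔟m, h𝔟p, h𝔟x, hn0, hn, hmem, Ideal.mul_le_right hmem⟩


/-! ### §4 (ED. 2) The norm witness of (NT-n): `𝔟 ⊔ (p) = ⊤ ↔ p ∤ N𝔟`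

ED. 2 (L3, LA3-p03 (g2)): for the COUNT side of (ρ-𝔟) the natural witness of (NT-n) is `n := N𝔟` itself, and the ANNIHILATOR PARTNER `𝔠` at level `n`
(`𝔟 · 𝔠 = (n)`, `N𝔟 · N𝔠 = n^{[F:ℚ]}`, `𝔠` prime to `p` when `p ∤ n`; `N(c•𝔟) = N𝔟`) is what a `K′ := λ_* A[(n) 𝔟̄⁻¹]` re-wire reads.  Milne Thm. 3.7 ∕ Rem. 3.12. -/

/-- `n ∈ 𝔟` (`n ∈ ℕ`) ⇒ `N𝔟 ∣ n^{[𝓞 F : ℤ]}` (`𝔟 ⊇ (n)` and `N((n)) = |Nm(n)| = n^{[F:ℚ]}`). [cite: MilneANT2008, Rem. 3.12 (p. 43)] -/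
theorem absNorm_dvd_pow_of_natCast_mem {𝔟 : Ideal (𝓞 F)} {n : ℕ} (h : ((n : ℕ) : 𝓞 F) ∈ 𝔟) :
    Ideal.absNorm 𝔟 ∣ n ^ Module.finrank ℤ (𝓞 F) := by
  have h1 : Ideal.absNorm 𝔟 ∣ Ideal.absNorm (Ideal.span {((n : ℕ) : 𝓞 F)}) :=
    Ideal.absNorm_dvd_absNorm_of_le ((Ideal.span_singleton_le_iff_mem _).mpr h)
  rwa [Ideal.absNorm_span_singleton, ← map_natCast (algebraMap ℤ (𝓞 F)) n, Algebra.norm_algebraMap, Int.natAbs_pow,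
    Int.natAbs_natCast] at h1

/-- **`𝔟 ⊔ (p) = ⊤ ⇒ p ∤ N𝔟`** (`𝔟 ≠ 0`, `p` prime): by (NT-n) some `n ∈ 𝔟` has `p ∤ n`, and `N𝔟 ∣ n^{[F:ℚ]}`. [cite: MilneANT2008, Thm. 3.7 (p. 42)] -/
theorem not_dvd_absNorm_of_sup_span_natCast_eq_top {𝔟 : Ideal (𝓞 F)} (h𝔟 : 𝔟 ≠ ⊥) {p : ℕ} (hp : p.Prime)
    (hcop : 𝔟 ⊔ Ideal.span {((p : ℕ) : 𝓞 F)} = ⊤) : ¬ p ∣ Ideal.absNorm 𝔟 := by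
  obtain ⟨n, -, hn, hmem⟩ := exists_nat_mem_not_dvd h𝔟 hp.one_lt.ne' hcop
  exact fun hdvd => hn (hp.dvd_of_dvd_pow (hdvd.trans (absNorm_dvd_pow_of_natCast_mem hmem)))

/-- **`p ∤ N𝔟 ⇒ 𝔟 ⊔ (p) = ⊤`** (`p` prime): a maximal ideal `P ⊇ 𝔟 + (p)` has `N P ∣ N𝔟` and `1 ≠ N P ∣ N((p)) = p^{[F:ℚ]}`, so `p ∣ N P ∣ N𝔟`.
[cite: MilneANT2008, Thm. 3.7 (p. 42)] -/
theorem sup_span_natCast_eq_top_of_not_dvd_absNorm {𝔟 : Ideal (𝓞 F)} {p : ℕ} (hp : p.Prime) (h : ¬ p ∣ Ideal.absNorm 𝔟) :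
    𝔟 ⊔ Ideal.span {((p : ℕ) : 𝓞 F)} = ⊤ := by
  by_contra hne
  obtain ⟨P, hPmax, hle⟩ := Ideal.exists_le_maximal _ hne
  have hP𝔟 : Ideal.absNorm P ∣ Ideal.absNorm 𝔟 := Ideal.absNorm_dvd_absNorm_of_le (le_sup_left.trans hle)
  have hpP : ((p : ℕ) : 𝓞 F) ∈ P := hle (Ideal.mem_sup_right (Ideal.mem_span_singleton_self _))
  have hPp : Ideal.absNorm P ∣ p ^ Module.finrank ℤ (𝓞 F) := absNorm_dvd_pow_of_natCast_mem hpP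
  obtain ⟨k, -, hk⟩ := (Nat.dvd_prime_pow hp).mp hPp
  have hk0 : k ≠ 0 := by
    rintro rfl
    rw [pow_zero, Ideal.absNorm_eq_one_iff] at hk
    exact hPmax.ne_top hk
  exact h ((dvd_pow_self p hk0).trans (hk ▸ hP𝔟))

/-- **`𝔟 ⊔ (p) = ⊤ ↔ p ∤ N𝔟`** for `𝔟 ≠ 0` and `p` prime. [cite: MilneANT2008, Thm. 3.7 (p. 42)] -/
theorem sup_span_natCast_eq_top_iff_not_dvd_absNorm {𝔟 : Ideal (𝓞 F)} (h𝔟 : 𝔟 ≠ ⊥) {p : ℕ} (hp : p.Prime) :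
    𝔟 ⊔ Ideal.span {((p : ℕ) : 𝓞 F)} = ⊤ ↔ ¬ p ∣ Ideal.absNorm 𝔟 :=
  ⟨not_dvd_absNorm_of_sup_span_natCast_eq_top h𝔟 hp, sup_span_natCast_eq_top_of_not_dvd_absNorm hp⟩

/-- `Nat.Coprime (N𝔟) p` costume. [cite: MilneANT2008, Thm. 3.7 (p. 42)] -/
theorem absNorm_coprime_of_sup_span_natCast_eq_top {𝔟 : Ideal (𝓞 F)} (h𝔟 : 𝔟 ≠ ⊥) {p : ℕ} (hp : p.Prime)
    (hcop : 𝔟 ⊔ Ideal.span {((p : ℕ) : 𝓞 F)} = ⊤) : Nat.Coprime (Ideal.absNorm 𝔟) p :=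
  Nat.coprime_comm.mp ((Nat.Prime.coprime_iff_not_dvd hp).mpr (not_dvd_absNorm_of_sup_span_natCast_eq_top h𝔟 hp hcop))

/-- **(NT-n) WITH THE NORM AS WITNESS**: `𝔟 ≠ 0`, `𝔟 ⊔ (p) = ⊤`, `p` prime ⇒ `0 < N𝔟`, `p ∤ N𝔟`, `N𝔟 ∈ 𝔟`. [cite: MilneANT2008, Thm. 3.7 (p. 42)] -/
theorem absNorm_pos_not_dvd_mem {𝔟 : Ideal (𝓞 F)} (h𝔟 : 𝔟 ≠ ⊥) {p : ℕ} (hp : p.Prime)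
    (hcop : 𝔟 ⊔ Ideal.span {((p : ℕ) : 𝓞 F)} = ⊤) :
    0 < Ideal.absNorm 𝔟 ∧ ¬ p ∣ Ideal.absNorm 𝔟 ∧ ((Ideal.absNorm 𝔟 : ℕ) : 𝓞 F) ∈ 𝔟 :=
  ⟨Nat.pos_of_ne_zero (by rwa [Ne, Ideal.absNorm_eq_zero_iff]), not_dvd_absNorm_of_sup_span_natCast_eq_top h𝔟 hp hcop,
    Ideal.absNorm_mem 𝔟⟩

/-! ### §5 (ED. 2) The annihilator partner `𝔠` at level `n`: `𝔟 · 𝔠 = (n)`, `N𝔟 · N𝔠 = n^{[F:ℚ]}`, `𝔠` prime to `p`; `N(σ𝔟) = N𝔟` -/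

/-- **THE PARTNER IDEAL AT LEVEL `n`**: `n ∈ 𝔟` ⇒ there is an integral `𝔠` with `𝔟 · 𝔠 = (n)` (`𝔠 = (n) 𝔟⁻¹`; to contain is to divide).
[cite: MilneANT2008, Thm. 3.7 (p. 42)] -/
theorem exists_mul_eq_span_natCast_of_mem {𝔟 : Ideal (𝓞 F)} {n : ℕ} (h : ((n : ℕ) : 𝓞 F) ∈ 𝔟) :
    ∃ 𝔠 : Ideal (𝓞 F), 𝔟 * 𝔠 = Ideal.span {((n : ℕ) : 𝓞 F)} := by
  obtain ⟨𝔠, h𝔠⟩ := Ideal.dvd_iff_le.mpr ((Ideal.span_singleton_le_iff_mem _).mpr h)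
  exact ⟨𝔠, h𝔠.symm⟩

/-- **`N𝔟 · N𝔠 = n^{[𝓞 F : ℤ]}`** for `𝔟 · 𝔠 = (n)`. [cite: MilneANT2008, Rem. 3.12 (p. 43)] -/
theorem absNorm_mul_absNorm_eq_pow_of_mul_eq_span_natCast {𝔟 𝔠 : Ideal (𝓞 F)} {n : ℕ}
    (h : 𝔟 * 𝔠 = Ideal.span {((n : ℕ) : 𝓞 F)}) : Ideal.absNorm 𝔟 * Ideal.absNorm 𝔠 = n ^ Module.finrank ℤ (𝓞 F) := by
  rw [← map_mul, h, Ideal.absNorm_span_singleton, ← map_natCast (algebraMap ℤ (𝓞 F)) n, Algebra.norm_algebraMap, Int.natAbs_pow,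
    Int.natAbs_natCast]

/-- The partner is nonzero when `n ≠ 0`. [cite: MilneANT2008, Thm. 3.7 (p. 42)] -/
theorem ne_bot_of_mul_eq_span_natCast {𝔟 𝔠 : Ideal (𝓞 F)} {n : ℕ} (hn : n ≠ 0)
    (h : 𝔟 * 𝔠 = Ideal.span {((n : ℕ) : 𝓞 F)}) : 𝔠 ≠ ⊥ := by
  rintro rfl
  rw [Ideal.mul_bot, eq_comm, Ideal.span_singleton_eq_bot] at h
  exact hn (by exact_mod_cast h)

omit [NumberField F] in
/-- **The partner is prime to `p` when `p ∤ n`** (`𝔠 ⊇ (n)` and `(n) + (p) = (1)` by Bézout). [cite: MilneANT2008, Thm. 3.7 (p. 42)] -/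
theorem sup_span_natCast_eq_top_of_mul_eq_span_natCast {𝔟 𝔠 : Ideal (𝓞 F)} {n p : ℕ} (hp : p.Prime) (hn : ¬ p ∣ n)
    (h : 𝔟 * 𝔠 = Ideal.span {((n : ℕ) : 𝓞 F)}) : 𝔠 ⊔ Ideal.span {((p : ℕ) : 𝓞 F)} = ⊤ := by
  have hcop : IsCoprime ((n : ℕ) : 𝓞 F) ((p : ℕ) : 𝓞 F) :=
    Nat.Coprime.cast (Nat.coprime_comm.mp ((Nat.Prime.coprime_iff_not_dvd hp).mpr hn))
  have hle : Ideal.span {((n : ℕ) : 𝓞 F)} ≤ 𝔠 := by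
    rw [← h]
    exact Ideal.mul_le_left
  exact top_le_iff.mp (((Ideal.sup_eq_top_iff_isCoprime _ _).mpr hcop).ge.trans (sup_le_sup_right hle _))

section PointwiseNorm

variable {G : Type*} [Group G] [MulSemiringAction G (𝓞 F)]

omit [NumberField F] in
/-- `𝓞 F ⧸ 𝔟 ≃+* 𝓞 F ⧸ σ𝔟` along the ring automorphism `σ`. [cite: NeukirchANT1999, Ch. I §9 (conjugate ideals `σ𝔞` under automorphisms, before (9.1))] -/
theorem nonempty_quotient_ringEquiv_pointwise_smul (g : G) (𝔟 : Ideal (𝓞 F)) : Nonempty (𝓞 F ⧸ 𝔟 ≃+* 𝓞 F ⧸ g • 𝔟) :=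
  ⟨Ideal.quotientEquiv 𝔟 (g • 𝔟) (MulSemiringAction.toRingEquiv G (𝓞 F) g) (by rw [Ideal.pointwise_smul_def]; rfl)⟩

/-- **`N(σ𝔟) = N𝔟`**: conjugate ideals have the same absolute norm. [cite: NeukirchANT1999, Ch. I §9 (conjugate ideals `σ𝔞` under automorphisms, before (9.1))] -/
theorem absNorm_pointwise_smul (g : G) (𝔟 : Ideal (𝓞 F)) : Ideal.absNorm (g • 𝔟) = Ideal.absNorm 𝔟 := by
  obtain ⟨e⟩ := nonempty_quotient_ringEquiv_pointwise_smul g 𝔟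
  rw [Ideal.absNorm_apply, Ideal.absNorm_apply, Submodule.cardQuot_apply, Submodule.cardQuot_apply]
  exact (Nat.card_congr e.toEquiv).symm

omit [NumberField F] in
/-- `σ n = n ∈ σ𝔟` for `n ∈ 𝔟`, `n ∈ ℕ`. [cite: NeukirchANT1999, Ch. I §9 (conjugate ideals `σ𝔞` under automorphisms, before (9.1))] -/
theorem natCast_mem_pointwise_smul (g : G) {𝔟 : Ideal (𝓞 F)} {n : ℕ} (h : ((n : ℕ) : 𝓞 F) ∈ 𝔟) :
    ((n : ℕ) : 𝓞 F) ∈ g • 𝔟 := by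
  have hfix : g • ((n : ℕ) : 𝓞 F) = ((n : ℕ) : 𝓞 F) := by
    rw [← MulSemiringAction.toRingHom_apply, map_natCast]
  simpa only [hfix] using Ideal.smul_mem_pointwise_smul g _ 𝔟 h

end PointwiseNorm

/-- **THE CM ANNIHILATOR PARTNER** (what a `K′ := λ_* A[(n) 𝔟̄⁻¹]` re-wire reads): for a CM field `F`, `𝔟 ≠ 0` prime to `p` (`p` prime) there are
`n ≥ 1` with `p ∤ n`, `n ∈ 𝔟 · c𝔟`, and an integral `𝔠` with `c𝔟 · 𝔠 = (n)`, `𝔠 ≠ 0`, `𝔠 ⊔ (p) = ⊤`, `𝔟 ∣ 𝔠` (indeed `𝔠 = 𝔟 · 𝔡` with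
`(𝔟 · c𝔟) · 𝔡 = (n)`), and `N𝔟 · N𝔠 = n^{[F:ℚ]}` (`N(c𝔟) = N𝔟`). [cite: MilneANT2008, Thm. 3.7 (p. 42)] -/
theorem exists_complexConj_smul_partner [IsCMField F] {𝔟 : Ideal (𝓞 F)} (h𝔟 : 𝔟 ≠ ⊥) {p : ℕ} (hp : p.Prime)
    (hcop : 𝔟 ⊔ Ideal.span {((p : ℕ) : 𝓞 F)} = ⊤) :
    ∃ (n : ℕ) (𝔠 𝔡 : Ideal (𝓞 F)), 0 < n ∧ ¬ p ∣ n ∧ ((n : ℕ) : 𝓞 F) ∈ 𝔟 * (IsCMField.complexConj F) • 𝔟 ∧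
      (IsCMField.complexConj F) • 𝔟 * 𝔠 = Ideal.span {((n : ℕ) : 𝓞 F)} ∧ 𝔠 = 𝔟 * 𝔡 ∧
      (𝔟 * (IsCMField.complexConj F) • 𝔟) * 𝔡 = Ideal.span {((n : ℕ) : 𝓞 F)} ∧ 𝔠 ≠ ⊥ ∧
      𝔠 ⊔ Ideal.span {((p : ℕ) : 𝓞 F)} = ⊤ ∧ Ideal.absNorm 𝔟 * Ideal.absNorm 𝔠 = n ^ Module.finrank ℤ (𝓞 F) := by
  obtain ⟨n, hn0, hn, hmem⟩ := exists_nat_mem_mul_complexConj_smul_not_dvd h𝔟 hp.one_lt.ne' hcop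
  obtain ⟨𝔡, h𝔡⟩ := exists_mul_eq_span_natCast_of_mem hmem
  have h𝔠 : (IsCMField.complexConj F) • 𝔟 * (𝔟 * 𝔡) = Ideal.span {((n : ℕ) : 𝓞 F)} := by
    rw [← h𝔡]; ring
  refine ⟨n, 𝔟 * 𝔡, 𝔡, hn0, hn, hmem, h𝔠, rfl, h𝔡, ne_bot_of_mul_eq_span_natCast hn0.ne' h𝔠,
    sup_span_natCast_eq_top_of_mul_eq_span_natCast hp hn h𝔠, ?_⟩
  rw [← absNorm_pointwise_smul (IsCMField.complexConj F) 𝔟]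
  exact absNorm_mul_absNorm_eq_pow_of_mul_eq_span_natCast h𝔠

end NumberField

end Literature.NumberTheory.NumberFields
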